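import Mathlib
import HarnessLib
import Literature.MathematicalPhysics.StatisticalMechanics.WeightedNormDominationSection
import Literature.MathematicalPhysics.StatisticalMechanics.TaylorPolynomialNormsExpectation
import Summits.HubbardSuperconductivity.HubbardSuperconductivity.Theorems.ComplexGFFStiffnessHypACumulantHolomorphicIntegral
import Summits.HubbardSuperconductivity.HubbardSuperconductivity.Theorems.ComplexGFFStiffnessHypACumulantHolomorphicTaylorNorm

/-!
# Crux `HypACumulant`, line `gnv` — structural pass, brick S4: the fluctuation integral
# `R F = ∫ F(· + ξ) μ(dξ)` of a holomorphic family of norm-bounded local functionals has holomorphic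
# Taylor coefficients

Route `route-HubbardSuperconductivity-ComplexGFFStiffness`, cruxes stmt-HubbardSuperconductivity-19154 /
-19155, shared research statement `OnePointLipschitz`, census (C3d′) (memo §7, step S4).  For a family
`W : ℂ → E → ℂ` of `T`-local `C^{r₀}` functionals with a UNIFORM weighted bound `‖W_σ‖_{T,w} ≤ C` on the
disc `|σ| < R`, a weight `w` dominated along the gauge section for the measure `μ` (the tree's
`WeightSectionDominated`, discharged for the torus tower in `FluctuationSmooth`), and holomorphic Taylor
coefficients of `W_σ` itself (e.g. from `…HolomorphicFamiliesFinite`), every Taylor coefficient of the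
fluctuation integral `σ ↦ D^s (R W_σ)‾(Tφ)(v)`, `s ≤ r₀`, is holomorphic on the disc:

* **`differentiableOn_coeff_integral_comp_add`** — by `D^s ∫ = ∫ D^s`
  (`QuantumFieldTheory.DerivDominated.iteratedFDeriv_integral_eq` with `TayNormLE.derivDominated_section`),
  evaluation commuting with the integral, and dominated holomorphy
  (`…HolomorphicIntegral.differentiableOn_integral_of_dominated_holomorphic`, bound `s!·C·H(ξ)·Π‖v_i‖`).

This is the hypothesis `hcoefhol` of `…HolomorphicCoeffNorm` for `K σ = R W_σ`.  All proved, no `sorry`.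

## References
* S. Adams, S. Buchholz, R. Kotecký, S. Müller, arXiv:1910.13564, (6.9), Lemma 8.4
  [AdamsBuchholzKoteckyMuller2019].
-/

noncomputable section

-- `Summit.<Summit>.<Problem>`: single-conjunct summit, the duplicate component is mandated (D-0017).
set_option linter.dupNamespace false

namespace Summit.HubbardSuperconductivity.HubbardSuperconductivity.Theorems.ComplexGFF

open MeasureTheory Metric Set Finset
open Literature.MathematicalPhysics.StatisticalMechanics.GradientRG
open Literature.MathematicalPhysics.QuantumFieldTheory

variable {E V : Type*} [NormedAddCommGroup E] [NormedSpace ℝ E] [FiniteDimensional ℝ E]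
  [MeasurableSpace E] [OpensMeasurableSpace E]
  [NormedAddCommGroup V] [NormedSpace ℝ V]

/-- **Holomorphic Taylor coefficients of the fluctuation integral of a holomorphic family.** -/
theorem differentiableOn_coeff_integral_comp_add {T : E →ₗ[ℝ] V} {r₀ : ℕ} {w : E → ℝ} {μ : Measure E}
    {W : ℂ → E → ℂ} {R C : ℝ} (hC : 0 ≤ C)
    (hloc : ∀ σ : ℂ, IsGaugeLocal T (W σ)) (hWc : ∀ σ : ℂ, ContDiff ℝ r₀ (W σ))
    (hWn : ∀ σ ∈ ball (0 : ℂ) R, TayNormLE T r₀ w (W σ) C) (hdom : WeightSectionDominated T w μ)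
    (hcoef : ∀ s : ℕ, s ≤ r₀ → ∀ (u : LinearMap.range T) (v : Fin s → LinearMap.range T),
      DifferentiableOn ℂ (fun σ => iteratedFDeriv ℝ s (gaugeLift T (W σ)) u v) (ball (0 : ℂ) R))
    (s : ℕ) (hs : s ≤ r₀) (φ : E) (v : Fin s → LinearMap.range T) :
    DifferentiableOn ℂ (fun σ => iteratedFDeriv ℝ s (gaugeLift T (fun ψ => ∫ ξ, W σ (ψ + ξ) ∂μ))
      (T.rangeRestrict φ) v) (ball (0 : ℂ) R) := by
  set u₀ : LinearMap.range T := T.rangeRestrict φ with hu₀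
  -- the integrand of the coefficient
  set g : ℂ → E → ℂ := fun σ ξ => iteratedFDeriv ℝ s (gaugeLift T (W σ)) (u₀ + T.rangeRestrict ξ) v with hg
  -- domination data along the section (Lemma 8.4)
  have hD : ∀ σ ∈ ball (0 : ℂ) R, DerivDominated r₀
      (fun (u : LinearMap.range T) (ξ : E) => gaugeLift T (W σ) (u + T.rangeRestrict ξ)) μ :=
    fun σ hσ => (hWn σ hσ).derivDominated_section hC (hWc σ) hdom
  -- the coefficient equals `∫ g σ ξ dμ` on the disc
  have hrepr : ∀ σ ∈ ball (0 : ℂ) R,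
      iteratedFDeriv ℝ s (gaugeLift T (fun ψ => ∫ ξ, W σ (ψ + ξ) ∂μ)) u₀ v = ∫ ξ, g σ ξ ∂μ := by
    intro σ hσ
    have e1 : gaugeLift T (fun ψ => ∫ ξ, W σ (ψ + ξ) ∂μ)
        = fun u => ∫ ξ, gaugeLift T (W σ) (u + T.rangeRestrict ξ) ∂μ :=
      funext fun u => gaugeLift_integral_comp_add (hloc σ) μ u
    rw [e1, (hD σ hσ).iteratedFDeriv_integral_eq s hs u₀]
    have hint : Integrable (fun ξ => iteratedFDeriv ℝ s
        (fun u : LinearMap.range T => gaugeLift T (W σ) (u + T.rangeRestrict ξ)) u₀) μ := (hD σ hσ).integrable hs u₀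
    have e2 : (∫ ξ, iteratedFDeriv ℝ s
          (fun u : LinearMap.range T => gaugeLift T (W σ) (u + T.rangeRestrict ξ)) u₀ ∂μ) v
        = ∫ ξ, iteratedFDeriv ℝ s
          (fun u : LinearMap.range T => gaugeLift T (W σ) (u + T.rangeRestrict ξ)) u₀ v ∂μ := by
      have h := ((ContinuousMultilinearMap.apply ℝ (fun _ : Fin s => LinearMap.range T) ℂ v).integral_comp_comm hint).symm
      simpa only [ContinuousMultilinearMap.apply_apply] using h
    rw [e2]
    refine integral_congr_ae (ae_of_all _ fun ξ => ?_)
    simp only [hg]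
    rw [iteratedFDeriv_comp_add_right]
  -- dominated holomorphy of `σ ↦ ∫ g σ ξ dμ`
  obtain ⟨ε, hε, H, hHi, hH⟩ := hdom u₀
  have hhol : DifferentiableOn ℂ (fun σ => ∫ ξ, g σ ξ ∂μ) (ball (0 : ℂ) R) := by
    refine differentiableOn_integral_of_dominated_holomorphic (g := fun ξ => (s.factorial : ℝ) * C * H ξ * ∏ i, ‖v i‖)
      (fun σ hσ => ?_) (ae_of_all _ fun ξ => ?_) (ae_of_all _ fun ξ σ hσ => ?_) ((hHi.const_mul _).mul_const _)
    · -- measurability of `g σ`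
      have hm := (hD σ hσ).meas s hs u₀
      have hm' : AEStronglyMeasurable (fun ξ => iteratedFDeriv ℝ s (gaugeLift T (W σ)) (u₀ + T.rangeRestrict ξ)) μ := by
        refine hm.congr (ae_of_all _ fun ξ => ?_)
        simp only
        rw [iteratedFDeriv_comp_add_right]
      exact (ContinuousMultilinearMap.apply ℝ (fun _ : Fin s => LinearMap.range T) ℂ v).continuous.comp_aestronglyMeasurable hm'
    · -- holomorphy of `σ ↦ g σ ξ`
      exact hcoef s hs (u₀ + T.rangeRestrict ξ) v
    · -- the bound `‖g σ ξ‖ ≤ s!·C·H(ξ)·Π‖v_i‖`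
      have hpt : T.rangeRestrict (gaugeSection T u₀ + ξ) = u₀ + T.rangeRestrict ξ := by
        rw [map_add, rangeRestrict_gaugeSection]
      have h1 : ‖iteratedFDeriv ℝ s (gaugeLift T (W σ)) (u₀ + T.rangeRestrict ξ)‖
          ≤ (s.factorial : ℝ) * tayNorm T r₀ (W σ) (gaugeSection T u₀ + ξ) := by
        rw [← hpt]
        exact norm_iteratedFDeriv_gaugeLift_le_factorial_mul_tayNorm T r₀ (W σ) _ hs
      have h2 : tayNorm T r₀ (W σ) (gaugeSection T u₀ + ξ) ≤ C * w (gaugeSection T u₀ + ξ) := hWn σ hσ _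
      have h3 : w (gaugeSection T u₀ + ξ) ≤ H ξ := hH ξ u₀ (by simpa using hε)
      calc ‖g σ ξ‖ ≤ ‖iteratedFDeriv ℝ s (gaugeLift T (W σ)) (u₀ + T.rangeRestrict ξ)‖ * ∏ i, ‖v i‖ :=
            ContinuousMultilinearMap.le_opNorm _ _
        _ ≤ ((s.factorial : ℝ) * (C * H ξ)) * ∏ i, ‖v i‖ := by
            refine mul_le_mul_of_nonneg_right ?_ (Finset.prod_nonneg fun i _ => norm_nonneg _)
            refine le_trans h1 (mul_le_mul_of_nonneg_left ?_ (Nat.cast_nonneg _))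
            exact le_trans h2 (mul_le_mul_of_nonneg_left h3 hC)
        _ = (s.factorial : ℝ) * C * H ξ * ∏ i, ‖v i‖ := by ring
  exact hhol.congr (fun σ hσ => hrepr σ hσ)

end Summit.HubbardSuperconductivity.HubbardSuperconductivity.Theorems.ComplexGFF

end
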